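import Summits.AtomisticToContinuum.HydrodynamicLimit.Theorems.JParityClosureParityInBandEos
import Literature.Analysis.FluidPDE.MVRelativeEnergyPointwise
import HarnessLib

/-!
# BF18 shell for functions (crux `ChaosClosesEuler`, stmt-AtomisticToContinuum-15141, line `Sketch`,
# stub `stub_bf18Shell`) — helper 3c: the extra equation-of-state facts of the monatomic excess class

WHAT. The pointwise package of the deterministic BF18 shell (helper 3b, `clamped_pointwise_package`) asks of the
equation of state, beyond the BF18 hypotheses supplied by `monatomicExcess_bf_hypotheses`, four elementary facts
which this file proves for `EulerEOS.monatomicExcess χ f` (`p = ρϑχ(ρ)`, `e = 3ϑ/2`) from the same inputs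
(`χ` `C²` on `(0,∞)`, `(ρχ)' > 0`, `|χ| ≤ B`):

* `monatomicExcess_chi_pos` — `χ > 0` on `(0,∞)`: `g(ρ) = ρχ(ρ)` is strictly increasing with `|g| ≤ Bρ → 0`;
* `monatomicExcess_p_pos` — positive pressure `p(ρ,ϑ) = ρϑχ(ρ) > 0` on the open quadrant;
* `monatomicExcess_strong_growth` — `|p| ≤ (2B/3)·ρe` (no entropy term, unlike BF's growth (3.1));
* `monatomicExcess_p_cold`, `monatomicExcess_p_vacuum` — the pressure vanishes on cold states
  (`ϑ(ρ, 0) = 0`) and on the vacuum, so that Lean's junk conventions there are harmless.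

No named fact is invoked.
-/

noncomputable section

namespace Summit.AtomisticToContinuum.HydrodynamicLimit.Theorems.ChaosClosesEulerShell

open Set
open Literature.Analysis.FluidPDE Literature.Analysis.FluidPDE.CompressibleEuler

variable {χ f : ℝ → ℝ}

/-- **`χ > 0` on `(0,∞)`** for `χ` differentiable there with `(ρχ)' = χ + ρχ' > 0` and `|χ| ≤ B`.
[folklore] -/
theorem monatomicExcess_chi_pos (hχ : ContDiffOn ℝ 2 χ (Ioi 0))
    (hmono : ∀ ρ, 0 < ρ → 0 < χ ρ + ρ * deriv χ ρ) {B : ℝ} (hB : ∀ ρ, 0 < ρ → |χ ρ| ≤ B)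
    {ρ : ℝ} (hρ : 0 < ρ) : 0 < χ ρ := by
  have hχd : ∀ r, 0 < r → DifferentiableAt ℝ χ r := fun r hr =>
    ((hχ.of_le (by norm_num : (1 : WithTop ℕ∞) ≤ 2)).differentiableOn one_ne_zero).differentiableAt
      (Ioi_mem_nhds hr)
  set g : ℝ → ℝ := fun r => r * χ r with hg
  have hgd : ∀ r, 0 < r → HasDerivAt g (χ r + r * deriv χ r) r := fun r hr => by
    have h := (hasDerivAt_id' r).mul (hχd r hr).hasDerivAt
    simp only [one_mul] at h
    exact h
  have hgc : ContinuousOn g (Ioi 0) := fun r hr => (hgd r hr).continuousAt.continuousWithinAt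
  have hgmono : StrictMonoOn g (Ioi 0) := by
    refine strictMonoOn_of_deriv_pos (convex_Ioi 0) hgc fun r hr => ?_
    rw [interior_Ioi] at hr
    rw [(hgd r hr).deriv]
    exact hmono r hr
  have hB0 : 0 ≤ B := (abs_nonneg _).trans (hB 1 one_pos)
  have hglow : ∀ r, 0 < r → -(B * r) ≤ g r := fun r hr => by
    have := (abs_le.1 (hB r hr)).1
    simp only [hg]; nlinarith
  -- `g (ρ/2) ≥ 0`
  have hhalf : 0 ≤ g (ρ / 2) := by
    by_contra hneg
    push Not at hneg
    set ε : ℝ := min (ρ / 4) (-g (ρ / 2) / (2 * (B + 1))) with hε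
    have hε0 : 0 < ε := lt_min (by positivity) (div_pos (by linarith) (by positivity))
    have hε1 : ε < ρ / 2 := lt_of_le_of_lt (min_le_left _ _) (by linarith)
    have hε2 : ε ≤ -g (ρ / 2) / (2 * (B + 1)) := min_le_right _ _
    have hlt : g ε < g (ρ / 2) := hgmono hε0 (by simp; positivity) hε1
    have hlow := hglow ε hε0
    have h3 : B * ε ≤ B * (-g (ρ / 2) / (2 * (B + 1))) := mul_le_mul_of_nonneg_left hε2 hB0
    have h4 : B * (-g (ρ / 2) / (2 * (B + 1))) ≤ -g (ρ / 2) / 2 := by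
      rw [mul_div_assoc', div_le_div_iff₀ (by positivity) (by norm_num)]
      nlinarith
    linarith
  have hlt : g (ρ / 2) < g ρ := hgmono (by simp; positivity) hρ (by linarith)
  have hgρ : 0 < g ρ := lt_of_le_of_lt hhalf hlt
  simp only [hg] at hgρ
  exact pos_of_mul_pos_right hgρ hρ.le

/-- **Positive pressure** `p(ρ,ϑ) = ρϑχ(ρ) > 0` on the open quadrant. [folklore] -/
theorem monatomicExcess_p_pos (hχ : ContDiffOn ℝ 2 χ (Ioi 0))
    (hmono : ∀ ρ, 0 < ρ → 0 < χ ρ + ρ * deriv χ ρ) {B : ℝ} (hB : ∀ ρ, 0 < ρ → |χ ρ| ≤ B)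
    (r θ : ℝ) (hr : 0 < r) (hθ : 0 < θ) : 0 < (EulerEOS.monatomicExcess χ f).p r θ := by
  have := monatomicExcess_chi_pos hχ hmono hB hr
  simp only [EulerEOS.monatomicExcess]
  positivity

/-- **Strong pressure growth** `|p| ≤ (2B/3) ρ e` for the monatomic class (`e = 3ϑ/2`). [folklore] -/
theorem monatomicExcess_strong_growth {B : ℝ} (hB : ∀ ρ, 0 < ρ → |χ ρ| ≤ B) :
    ∃ cg : ℝ, 0 ≤ cg ∧ ∀ r θ : ℝ, 0 < r → 0 < θ →
      |(EulerEOS.monatomicExcess χ f).p r θ| ≤ cg * (r * (EulerEOS.monatomicExcess χ f).e r θ) := by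
  have hB0 : 0 ≤ B := (abs_nonneg _).trans (hB 1 one_pos)
  refine ⟨2 * B / 3, by positivity, fun r θ hr hθ => ?_⟩
  simp only [EulerEOS.monatomicExcess]
  rw [abs_mul, abs_mul, abs_of_pos hr, abs_of_pos hθ]
  have := hB r hr
  have e : 2 * B / 3 * (r * (3 / 2 * θ)) = r * θ * B := by ring
  rw [e]
  exact mul_le_mul_of_nonneg_left this (by positivity)

/-- The pressure vanishes on cold states: `p(ρ, ϑ(ρ, 0)) = 0` (`ϑ(ρ,0) = 0`). [folklore] -/
theorem monatomicExcess_p_cold (ρ : ℝ) :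
    (EulerEOS.monatomicExcess χ f).p ρ (stateTemp (EulerEOS.monatomicExcess χ f) ρ 0) = 0 := by
  simp [EulerEOS.monatomicExcess, stateTemp]

/-- The pressure vanishes on the vacuum: `p(0, ϑ) = 0`. [folklore] -/
theorem monatomicExcess_p_vacuum (θ : ℝ) : (EulerEOS.monatomicExcess χ f).p 0 θ = 0 := by
  simp [EulerEOS.monatomicExcess]

/-- The temperature of the state `(ρ, E)` is `2E/(3ρ)`. [folklore] -/
theorem monatomicExcess_stateTemp (ρ E : ℝ) :
    stateTemp (EulerEOS.monatomicExcess χ f) ρ E = 2 * E / (3 * ρ) := rfl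

/-- REGISTERED SUB-GOAL `stub_bf18ShellMonatomic` of the line `Sketch` (helper 3c of `stub_bf18Shell`): `χ > 0`
for the monatomic excess class. [folklore] -/
theorem stub_bf18ShellMonatomic :
    ∀ (χ : ℝ → ℝ) (B ρ : ℝ), ContDiffOn ℝ 2 χ (Set.Ioi 0) → (∀ a, 0 < a → 0 < χ a + a * deriv χ a) →
      (∀ a, 0 < a → |χ a| ≤ B) → 0 < ρ → 0 < χ ρ :=
  fun _χ _B _ρ hχ hmono hB hρ => monatomicExcess_chi_pos hχ hmono hB hρ

end Summit.AtomisticToContinuum.HydrodynamicLimit.Theorems.ChaosClosesEulerShell
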